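import Summits.BirchSwinnertonDyer.BirchSwinnertonDyer.Theorems.ManinLocalTwoThreeKummerDiamondStepTwoPropositionAFinish
import HarnessLib

/-!
# es's STEP 2 (D6 of LEAD's `kummer_diamond` line), V: PROPOSITION A in abstract form — the index-`4` world forces `2⁵ ∣ N`, `S′ = {2^a, p^b}`,
# `p ≡ 3 (mod 4)`, `δ(T) = {0, h₁, h₂, h₁ + h₂}` with its odd elements `h₁, h₂`
(route `ManinLocalTwoThree`, crux C2 `ManinOddAtFour` stmt-BirchSwinnertonDyer-22967; cell bsd-f2-manin, prover p2 gen 21; es g38 PROOF-Ees185-186.md §4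
PROPOSITION A (STEP 1–2) / MEMO-es §59.5; LEAD card `Cruxes/ManinOddAtFour/Lines/kummer_diamond.md` node D6; `--supports stmt-BirchSwinnertonDyer-22967`)

`propositionA` is D6 with every analytic / geometric input abstracted into hypotheses that the other nodes discharge:
`w` = `γ ↦ π₀(c₀{∞,γ∞}_f/2)` (D8/D9: additive, trivial on `Γ₁(N)` in the index-`4` world, exponent `2`, LEMMA M E-es-184 = `diamondCharacterConductorLaw_holds`,
`|im| = |W₀[2]| = 4`); `cyc σ d` = `σ(e^{2πi/N}) = e^{2πi d/N}` on `ℂ ≃ₐ[ℚ] ℂ` (supply = automorphism extension, `c` = complex conjugation); `𝒱` = the Kummer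
classes `σ ↦ σS − S`, `2S ∈ W₀(ℚ)_tors` (`|𝒱| ≤ 4`, D3/D4); the THEOREM-K shape = es g39 `indexFour_kummerDiamondReciprocity` (D5, mod T-es-75 ∧ CES);
the odd element = `δ(T₁)` (D4, real signs).  OUTPUT for D7 (LEAD p759380 `legendre_descent_cases`): `2⁵ ∣ N`; `p ≡ 3 (4)`; `v ≠ 0`; the odd classes are
`h₁, h₂`; `h₂ = v ⊗ ψ_{−p}` (`h₂ σ = 0 ↔ χ(σ)` square mod `p`); `h₁` a bijection `(ℤ/8)ˣ → im ϖ`.  UNCONDITIONAL; nothing about E-es-185, C2, Manin's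
conjecture or BSD is proved.  No definitions, no sorry. [cite: Stevens1989, §2] [cite: Manin1972, Prop. 1.4 / Thm. 1.6]
-/

set_option autoImplicit false
-- lint-debt: the directory name repeats the summit name (sibling precedent `ManinLocalTwoThreeKummerDiamondStepTwoTwoAdic.lean`)
set_option linter.dupNamespace false

open scoped MatrixGroups
open CongruenceSubgroup

namespace Summit.BirchSwinnertonDyer.BirchSwinnertonDyer.Theorems.ManinLocalTwoThree.StepTwo

variable {N : ℕ}

section Main

/-- **PROPOSITION A (es g38 PROOF-Ees185-186 §4, STEP 1–2), abstract form.**  DATA: `w : Γ₀(N) → V` additive, trivial on `d_γ ≡ 1 (mod N)`, of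
exponent `2`, killing `d_γ ≡ ±1 (mod M)` (LEMMA M, E-es-184, with `ϖ(−1) = 0`), with `≥ 4` values (`K = Λ₀/Λ₁ ≅ E[2]`); a Galois-type set `G` with a
cyclotomic relation `cyc σ d` («`σ(ζ_N) = ζ_N^d`»: every `σ` has an invertible `d`, every `d` coprime to `N` occurs, `c ↦ −1`); a finite subgroup `𝒱` of
functions `G → V` with `|𝒱| ≤ 4` (`δ(T)`, `|T/2T| = 4`) containing, for every coprime splitting `N = Q·y`, a function `f_Q` with THEOREM K's shape
`f_Q(σ) = w(γ)` whenever `d_γ ≡ d′ (Q)`, `≡ 1 (y)`, `dd′ ≡ 1 (N)`; and ONE odd element (`f(c) ≠ 0`: `δ(T₁)` is odd).  CONCLUSION: `2⁵ ∣ N`, and there are an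
odd prime `p ≡ 3 (mod 4)` with `p^b ∥ N`, `2^a ∥ N` (`a ≥ 5`), `v ≠ 0` in `im ϖ` and `h₁ = f_{2^a}`, `h₂ = f_{p^b}` in `𝒱` with `𝒱 = {0, h₁, h₂, h₁ + h₂}`,
`h₁(c) = h₂(c) = v`, the odd elements of `𝒱` are exactly `h₁, h₂`, `h₂(σ) = 0 ↔ χ(σ) ∈ (ℤ/p)ˣ²` (i.e. `h₂ = v ⊗ ψ_{−p}`), `h₂ ∈ {0, v}`, and `h₁` is a
bijection `χ(σ) mod 8 ↦ h₁(σ)` onto `im ϖ` (es: «`ϖ_{2^a}` induces `(ℤ/8)ˣ ⥲ K`»).  UNCONDITIONAL abstract group theory; the instantiation (THEOREM K =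
es g39 `indexFour_kummerDiamondReciprocity` mod T-es-75 ∧ CES, the Kummer subgroup `𝒱`, complex conjugation) is the business of D3/D4/D5; nothing about
E-es-185, C2, Manin's conjecture or BSD is proved here. [cite: Stevens1989, §2] [cite: Manin1972, Prop. 1.4 / Thm. 1.6] -/
theorem propositionA [NeZero N] {V G : Type*} [AddCommGroup V] (w : Gamma0 N → V) (cyc : G → ℤ → Prop) (c : G)
    (hmul : ∀ γ γ' : Gamma0 N, w (γ * γ') = w γ + w γ')
    (hone : ∀ γ : Gamma0 N, ((((γ : SL(2, ℤ)) 1 1 : ℤ)) : ZMod N) = 1 → w γ = 0) (h2 : ∀ γ : Gamma0 N, w γ + w γ = 0)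
    (hM : ∀ γ : Gamma0 N, ((((γ : SL(2, ℤ)) 1 1 : ℤ)) : ZMod (Summit.BirchSwinnertonDyer.Rank1Residual.ManinAdditive.KummerDiamond.ceilSqrtLevel N)) = 1 ∨
      ((((γ : SL(2, ℤ)) 1 1 : ℤ)) : ZMod (Summit.BirchSwinnertonDyer.Rank1Residual.ManinAdditive.KummerDiamond.ceilSqrtLevel N)) = -1 → w γ = 0)
    (hK : 4 ≤ (Set.range w).ncard)
    (hcyc : ∀ σ : G, ∃ d d' : ℤ, ((d * d' : ℤ) : ZMod N) = 1 ∧ cyc σ d)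
    (hsup : ∀ d : ℤ, IsCoprime d (N : ℤ) → ∃ σ : G, cyc σ d) (hc : cyc c (-1))
    (𝒱 : AddSubgroup (G → V)) (h𝒱fin : (𝒱 : Set (G → V)).Finite) (h𝒱 : Nat.card 𝒱 ≤ 4)
    (hKum : ∀ Q y : ℕ, Q * y = N → Nat.Coprime Q y → ∃ f ∈ 𝒱, ∀ (σ : G) (d d' : ℤ), ((d * d' : ℤ) : ZMod N) = 1 → cyc σ d →
      ∀ γ : Gamma0 N, ((((γ : SL(2, ℤ)) 1 1 : ℤ)) : ZMod Q) = (d' : ZMod Q) → ((((γ : SL(2, ℤ)) 1 1 : ℤ)) : ZMod y) = 1 → f σ = w γ)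
    (hodd : ∃ f ∈ 𝒱, f c ≠ 0) :
    2 ^ 5 ∣ N ∧
    ∃ (p a b y₂ yp : ℕ) (v : V) (h₁ h₂ : G → V),
      p.Prime ∧ p ≠ 2 ∧ p % 4 = 3 ∧ 5 ≤ a ∧ 1 ≤ b ∧ 2 ^ a * y₂ = N ∧ Nat.Coprime (2 ^ a) y₂ ∧ p ^ b * yp = N ∧ Nat.Coprime (p ^ b) yp ∧
      v ≠ 0 ∧ (∃ γ : Gamma0 N, w γ = v) ∧ h₁ ∈ 𝒱 ∧ h₂ ∈ 𝒱 ∧ h₁ ≠ h₂ ∧ h₁ c = v ∧ h₂ c = v ∧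
      (∀ f ∈ 𝒱, f = 0 ∨ f = h₁ ∨ f = h₂ ∨ f = h₁ + h₂) ∧ (∀ f ∈ 𝒱, f c ≠ 0 → f = h₁ ∨ f = h₂) ∧
      (∀ (σ : G) (d d' : ℤ), ((d * d' : ℤ) : ZMod N) = 1 → cyc σ d → ∀ γ : Gamma0 N,
        ((((γ : SL(2, ℤ)) 1 1 : ℤ)) : ZMod (2 ^ a)) = (d' : ZMod (2 ^ a)) → ((((γ : SL(2, ℤ)) 1 1 : ℤ)) : ZMod (y₂)) = 1 → h₁ σ = w γ) ∧
      (∀ (σ : G) (d d' : ℤ), ((d * d' : ℤ) : ZMod N) = 1 → cyc σ d → ∀ γ : Gamma0 N,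
        ((((γ : SL(2, ℤ)) 1 1 : ℤ)) : ZMod (p ^ b)) = (d' : ZMod (p ^ b)) → ((((γ : SL(2, ℤ)) 1 1 : ℤ)) : ZMod (yp)) = 1 → h₂ σ = w γ) ∧
      (∀ (σ : G) (d d' : ℤ), ((d * d' : ℤ) : ZMod N) = 1 → cyc σ d → (h₂ σ = 0 ↔ IsSquare ((d : ZMod p)))) ∧
      (∀ σ : G, h₂ σ = 0 ∨ h₂ σ = v) ∧
      (∀ (σ τ : G) (d d' e e' : ℤ), ((d * d' : ℤ) : ZMod N) = 1 → cyc σ d → ((e * e' : ℤ) : ZMod N) = 1 → cyc τ e →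
        (h₁ σ = h₁ τ ↔ (d : ZMod 8) = (e : ZMod 8))) ∧
      (∀ γ : Gamma0 N, ∃ σ : G, h₁ σ = w γ) := by
  have hN0 : N ≠ 0 := NeZero.ne N
  -- `ϖ(−1) = 0`
  have hneg : ∀ γ : Gamma0 N, ((((γ : SL(2, ℤ)) 1 1 : ℤ)) : ZMod N) = -1 → w γ = 0 := by
    intro γ h
    refine hM γ (Or.inr ?_)
    have h' : ((((γ : SL(2, ℤ)) 1 1 : ℤ)) : ZMod N) = ((-1 : ℤ) : ZMod N) := by rw [h]; push_cast; rfl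
    have h'' := cast_down (ceilSqrtLevel_dvd N) h'
    push_cast at h''; exact h''
  -- `f_N`
  obtain ⟨fN, hfN𝒱, hfN⟩ := hKum N 1 (mul_one N) (Nat.coprime_one_right N)
  have hfNsurj : ∀ γ : Gamma0 N, ∃ σ : G, fN σ = w γ := fun γ ↦
    kum_surj w cyc hsup hfN γ (Subsingleton.elim _ _)
  have hfN0 : fN ≠ 0 := by
    intro h0
    have hall : ∀ γ : Gamma0 N, w γ = 0 ∨ w γ = (0 : V) := fun γ ↦ by
      obtain ⟨σ, hσ⟩ := hfNsurj γ
      exact Or.inl (by rw [← hσ, h0, Pi.zero_apply])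
    have := ncard_range_le_two hall
    omega
  -- the first active prime
  have hfN' : ∀ (σ : G) (d d' : ℤ), ((d * d' : ℤ) : ZMod N) = 1 → cyc σ d → ∀ γ : Gamma0 N,
      ((((γ : SL(2, ℤ)) 1 1 : ℤ)) : ZMod N) = (d' : ZMod N) → ((((γ : SL(2, ℤ)) 1 1 : ℤ)) : ZMod (N / N)) = 1 → fN σ = w γ := by
    rw [Nat.div_self (Nat.pos_of_ne_zero hN0)]; exact hfN
  obtain ⟨p₁, b₁, y₁, f₁, hp₁, hb₁, hN₁, hcop₁, -, hf₁𝒱, hf₁0, hf₁⟩ :=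
    exists_active_prime w cyc hmul hone hcyc 𝒱 hKum N dvd_rfl
      (by rw [Nat.div_self (Nat.pos_of_ne_zero hN0)]; exact Nat.coprime_one_right N) fN hfN' hfN0
  -- its complement is active too
  obtain ⟨g₁, hg₁𝒱, hg₁⟩ := hKum y₁ (p₁ ^ b₁) (by rw [mul_comm]; exact hN₁) hcop₁.symm
  have hg₁0 : g₁ ≠ 0 := kum_complement_ne_zero w cyc hmul hone h2 hneg hK hsup hp₁ hN₁ hcop₁ hg₁
  have hsum₁ : f₁ + g₁ = fN := by
    have hf₁' : ∀ (σ : G) (d d' : ℤ), ((d * d' : ℤ) : ZMod N) = 1 → cyc σ d → ∀ γ : Gamma0 N,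
        ((((γ : SL(2, ℤ)) 1 1 : ℤ)) : ZMod (p₁ ^ b₁)) = (d' : ZMod (p₁ ^ b₁)) →
        ((((γ : SL(2, ℤ)) 1 1 : ℤ)) : ZMod (y₁ * 1)) = 1 → f₁ σ = w γ := by rw [mul_one]; exact hf₁
    have hg₁' : ∀ (σ : G) (d d' : ℤ), ((d * d' : ℤ) : ZMod N) = 1 → cyc σ d → ∀ γ : Gamma0 N,
        ((((γ : SL(2, ℤ)) 1 1 : ℤ)) : ZMod y₁) = (d' : ZMod y₁) →
        ((((γ : SL(2, ℤ)) 1 1 : ℤ)) : ZMod (p₁ ^ b₁ * 1)) = 1 → g₁ σ = w γ := by rw [mul_one]; exact hg₁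
    have hadd := kum_add w cyc hmul hone (A := p₁ ^ b₁) (B := y₁) (C := 1) (by rw [mul_one, hN₁]) hcop₁
      (Nat.coprime_one_right _) (Nat.coprime_one_right _) hf₁' hg₁'
    rw [hN₁] at hadd
    exact kum_unique w cyc (mul_one N) (Nat.coprime_one_right N) hcyc hadd hfN
  -- the second active prime
  have hy₁0 : y₁ ≠ 0 := fun h ↦ hN0 (by rw [← hN₁, h, mul_zero])
  have hNy₁ : N / y₁ = p₁ ^ b₁ := Nat.div_eq_of_eq_mul_left (Nat.pos_of_ne_zero hy₁0) hN₁.symm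
  have hg₁'' : ∀ (σ : G) (d d' : ℤ), ((d * d' : ℤ) : ZMod N) = 1 → cyc σ d → ∀ γ : Gamma0 N,
      ((((γ : SL(2, ℤ)) 1 1 : ℤ)) : ZMod y₁) = (d' : ZMod y₁) → ((((γ : SL(2, ℤ)) 1 1 : ℤ)) : ZMod (N / y₁)) = 1 → g₁ σ = w γ := by
    rw [hNy₁]; exact hg₁
  obtain ⟨p₂, b₂, y₂, f₂, hp₂, hb₂, hN₂, hcop₂, hp₂y₁, hf₂𝒱, hf₂0, hf₂⟩ :=
    exists_active_prime w cyc hmul hone hcyc 𝒱 hKum y₁ ⟨p₁ ^ b₁, by rw [mul_comm, hN₁]⟩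
      (by rw [hNy₁]; exact hcop₁.symm) g₁ hg₁'' hg₁0
  have hp₁₂ : p₁ ≠ p₂ := by
    rintro rfl
    have hcp : Nat.Coprime p₁ y₁ := (Nat.coprime_pow_left_iff hb₁ _ _).mp hcop₁
    exact (Nat.Prime.coprime_iff_not_dvd hp₁).mp hcp hp₂y₁
  obtain ⟨g₂, hg₂𝒱, hg₂⟩ := hKum y₂ (p₂ ^ b₂) (by rw [mul_comm]; exact hN₂) hcop₂.symm
  have hg₂0 : g₂ ≠ 0 := kum_complement_ne_zero w cyc hmul hone h2 hneg hK hsup hp₂ hN₂ hcop₂ hg₂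
  have hsum₂ : f₂ + g₂ = fN := by
    have hf₂' : ∀ (σ : G) (d d' : ℤ), ((d * d' : ℤ) : ZMod N) = 1 → cyc σ d → ∀ γ : Gamma0 N,
        ((((γ : SL(2, ℤ)) 1 1 : ℤ)) : ZMod (p₂ ^ b₂)) = (d' : ZMod (p₂ ^ b₂)) →
        ((((γ : SL(2, ℤ)) 1 1 : ℤ)) : ZMod (y₂ * 1)) = 1 → f₂ σ = w γ := by rw [mul_one]; exact hf₂
    have hg₂' : ∀ (σ : G) (d d' : ℤ), ((d * d' : ℤ) : ZMod N) = 1 → cyc σ d → ∀ γ : Gamma0 N,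
        ((((γ : SL(2, ℤ)) 1 1 : ℤ)) : ZMod y₂) = (d' : ZMod y₂) →
        ((((γ : SL(2, ℤ)) 1 1 : ℤ)) : ZMod (p₂ ^ b₂ * 1)) = 1 → g₂ σ = w γ := by rw [mul_one]; exact hg₂
    have hadd := kum_add w cyc hmul hone (A := p₂ ^ b₂) (B := y₂) (C := 1) (by rw [mul_one, hN₂]) hcop₂
      (Nat.coprime_one_right _) (Nat.coprime_one_right _) hf₂' hg₂'
    rw [hN₂] at hadd
    exact kum_unique w cyc (mul_one N) (Nat.coprime_one_right N) hcyc hadd hfN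
  -- independence: `f₁ ≠ f₂`
  have hQ₂y₁ : p₂ ^ b₂ ∣ y₁ := by
    have hcp : Nat.Coprime (p₂ ^ b₂) (p₁ ^ b₁) :=
      Nat.Coprime.pow _ _ ((Nat.coprime_primes hp₂ hp₁).mpr (Ne.symm hp₁₂))
    exact hcp.dvd_of_dvd_mul_left (by rw [hN₁, ← hN₂]; exact dvd_mul_right _ _)
  have hf₁₂ : f₁ ≠ f₂ := by
    obtain ⟨σ₀, hσ₀⟩ := Function.ne_iff.mp hf₁0
    obtain ⟨γ₀, hγ₀y, hγ₀⟩ := kum_apply w cyc hN₁ hcop₁ hcyc hf₁ σ₀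
    obtain ⟨u, t, hut⟩ := isCoprime_lowerRight γ₀
    have hu : IsCoprime u (N : ℤ) := ⟨((γ₀ : SL(2, ℤ)) 1 1 : ℤ), t, by linear_combination hut⟩
    obtain ⟨σ, hσ⟩ := hsup u hu
    have hue : ((u * ((γ₀ : SL(2, ℤ)) 1 1 : ℤ) : ℤ) : ZMod N) = 1 := by
      have e : u * ((γ₀ : SL(2, ℤ)) 1 1 : ℤ) = 1 + (-t) * N := by linear_combination hut
      rw [e]; push_cast; simp
    have h1 : f₁ σ = w γ₀ := hf₁ σ u _ hue hσ γ₀ rfl hγ₀y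
    obtain ⟨γ', hγ'Q, hγ'y⟩ := exists_gamma0_of_inv hN₂ hcop₂ hue
    have h2' : f₂ σ = w γ' := hf₂ σ u _ hue hσ γ' hγ'Q hγ'y
    have hγ'1 : ((((γ' : SL(2, ℤ)) 1 1 : ℤ)) : ZMod N) = 1 := by
      have hQ : ((((γ' : SL(2, ℤ)) 1 1 : ℤ)) : ZMod (p₂ ^ b₂)) = 1 := by rw [hγ'Q]; exact cast_down_one hQ₂y₁ hγ₀y
      have h := (intCast_zmod_mul_eq_iff_of_coprime hcop₂ ((γ' : SL(2, ℤ)) 1 1 : ℤ) 1).mpr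
        ⟨by rw [hQ]; push_cast; rfl, by rw [hγ'y]; push_cast; rfl⟩
      rw [hN₂] at h; push_cast at h; exact h
    intro heq
    apply hσ₀
    rw [hγ₀, ← h1, heq, h2', hone γ' hγ'1, Pi.zero_apply]
  -- `𝒱 = {0, f₁, f₂, f₁ + f₂}`
  have hff : ∀ {Q y : ℕ} (hQy : Q * y = N) (hcop : Nat.Coprime Q y) {f : G → V},
      (∀ (σ : G) (d d' : ℤ), ((d * d' : ℤ) : ZMod N) = 1 → cyc σ d → ∀ γ : Gamma0 N,
        ((((γ : SL(2, ℤ)) 1 1 : ℤ)) : ZMod Q) = (d' : ZMod Q) → ((((γ : SL(2, ℤ)) 1 1 : ℤ)) : ZMod y) = 1 → f σ = w γ) →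
      f + f = 0 := by
    intro Q y hQy hcop f hf
    funext σ
    obtain ⟨γ, -, hγ⟩ := kum_apply w cyc hQy hcop hcyc hf σ
    rw [Pi.add_apply, hγ, Pi.zero_apply]; exact h2 γ
  have hf₁₁ := hff hN₁ hcop₁ hf₁
  have hf₂₂ := hff hN₂ hcop₂ hf₂
  have hs0 : f₁ + f₂ ≠ 0 := by
    intro h; apply hf₁₂
    have : f₁ = -f₂ := eq_neg_of_add_eq_zero_left h
    rw [this]; exact (neg_eq_of_add_eq_zero_left hf₂₂).symm ▸ rfl
  have hs1 : f₁ + f₂ ≠ f₁ := fun h ↦ hf₂0 (by simpa using h)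
  have hs2 : f₁ + f₂ ≠ f₂ := fun h ↦ hf₁0 (by simpa using h)
  have hTsub : ({0, f₁, f₂, f₁ + f₂} : Set (G → V)) ⊆ (𝒱 : Set (G → V)) := by
    intro f hf
    simp only [Set.mem_insert_iff, Set.mem_singleton_iff] at hf
    rcases hf with rfl | rfl | rfl | rfl
    · exact 𝒱.zero_mem
    · exact hf₁𝒱
    · exact hf₂𝒱
    · exact 𝒱.add_mem hf₁𝒱 hf₂𝒱
  have hT4 : ({0, f₁, f₂, f₁ + f₂} : Set (G → V)).ncard = 4 := by
    rw [Set.ncard_insert_of_notMem (by simp [Ne.symm hf₁0, Ne.symm hf₂0, Ne.symm hs0]),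
      Set.ncard_insert_of_notMem (by simp [hf₁₂, Ne.symm hs1]), Set.ncard_pair (Ne.symm hs2)]
  have h𝒱eq : (𝒱 : Set (G → V)) = {0, f₁, f₂, f₁ + f₂} :=
    (Set.eq_of_subset_of_ncard_le hTsub (by rw [hT4, ← Nat.card_coe_set_eq]; exact h𝒱) h𝒱fin).symm
  have hmem : ∀ f ∈ 𝒱, f = 0 ∨ f = f₁ ∨ f = f₂ ∨ f = f₁ + f₂ := by
    intro f hf
    have hf' : f ∈ (𝒱 : Set (G → V)) := hf
    rw [h𝒱eq] at hf'
    simpa only [Set.mem_insert_iff, Set.mem_singleton_iff] using hf'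
  -- `f_N = f₁ + f₂`
  have hfN12 : fN = f₁ + f₂ := by
    rcases hmem fN hfN𝒱 with h | h | h | h
    · exact absurd h hfN0
    · exact absurd (by rw [← hsum₁] at h; simpa using h) hg₁0
    · exact absurd (by rw [← hsum₂] at h; simpa using h) hg₂0
    · exact h
  -- parity at `c`
  have hfNc : fN c = 0 := by
    obtain ⟨γm, hγm⟩ := exists_gamma0_lowerRight_eq_neg_one (N := N)
    have hdd : (((-1) * (-1) : ℤ) : ZMod N) = 1 := by push_cast; ring
    rw [hfN c (-1) (-1) hdd hc γm (by rw [hγm]) (Subsingleton.elim _ _)]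
    exact hneg γm (by rw [hγm]; push_cast; rfl)
  have hc12 : f₂ c = f₁ c := by
    have h : f₁ c + f₂ c = 0 := by rw [← Pi.add_apply, ← hfN12, hfNc]
    have h11 : f₁ c + f₁ c = 0 := by rw [← Pi.add_apply, hf₁₁, Pi.zero_apply]
    calc f₂ c = -(f₁ c) := eq_neg_of_add_eq_zero_right h
      _ = f₁ c := by rw [neg_eq_of_add_eq_zero_right h11]
  have hoddmem : ∀ f ∈ 𝒱, f c ≠ 0 → f = f₁ ∨ f = f₂ := by
    intro f hf hfc
    rcases hmem f hf with rfl | h | h | rfl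
    · exact absurd rfl hfc
    · exact Or.inl h
    · exact Or.inr h
    · exact absurd (by rw [← hfN12, hfNc]) hfc
  have hv0 : f₁ c ≠ 0 := by
    obtain ⟨f, hf, hfc⟩ := hodd
    rcases hoddmem f hf hfc with rfl | rfl
    · exact hfc
    · rwa [hc12] at hfc
  have hsum : ∀ γ : Gamma0 N, ∃ σ : G, w γ = f₁ σ + f₂ σ := fun γ ↦ by
    obtain ⟨σ, hσ⟩ := hfNsurj γ
    exact ⟨σ, by rw [← hσ, hfN12, Pi.add_apply]⟩
  have hvmem : ∃ γ : Gamma0 N, w γ = f₁ c := by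
    obtain ⟨γ, -, hγ⟩ := kum_apply w cyc hN₁ hcop₁ hcyc hf₁ c
    exact ⟨γ, hγ.symm⟩
  -- one of the two primes is `2`
  have h2mem : p₁ = 2 ∨ p₂ = 2 := by
    by_contra hne
    rw [not_or] at hne
    obtain ⟨v₁, hv₁⟩ := exists_forall_eq_zero_or_eq_primePow w hmul hone h2 hp₁ hne.1 hN₁ hcop₁
    obtain ⟨v₂, hv₂⟩ := exists_forall_eq_zero_or_eq_primePow w hmul hone h2 hp₂ hne.2 hN₂ hcop₂
    obtain ⟨γa, hγay, hγa⟩ := kum_apply w cyc hN₁ hcop₁ hcyc hf₁ c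
    obtain ⟨γb, hγby, hγb⟩ := kum_apply w cyc hN₂ hcop₂ hcyc hf₂ c
    have hv₁v : v₁ = f₁ c := by
      rcases hv₁ γa hγay with h | h
      · exact absurd (hγa.trans h) hv0
      · rw [← h, hγa]
    have hv₂v : v₂ = f₁ c := by
      rcases hv₂ γb hγby with h | h
      · exact absurd (hγb.trans h) (by rw [hc12]; exact hv0)
      · rw [← h, ← hγb, hc12]
    have h11 : f₁ c + f₁ c = 0 := by rw [← Pi.add_apply, hf₁₁, Pi.zero_apply]
    have hall : ∀ γ : Gamma0 N, w γ = 0 ∨ w γ = f₁ c := by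
      intro γ
      obtain ⟨σ, hσ⟩ := hsum γ
      obtain ⟨γ₁', h₁y, h₁w⟩ := kum_apply w cyc hN₁ hcop₁ hcyc hf₁ σ
      obtain ⟨γ₂', h₂y, h₂w⟩ := kum_apply w cyc hN₂ hcop₂ hcyc hf₂ σ
      rw [hσ, h₁w, h₂w]
      rcases hv₁ γ₁' h₁y with h | h <;> rcases hv₂ γ₂' h₂y with h' | h' <;> rw [h, h']
      · left; rw [add_zero]
      · right; rw [zero_add, hv₂v]
      · right; rw [add_zero, hv₁v]
      · left; rw [hv₁v, hv₂v, h11]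
    have := ncard_range_le_two hall
    omega
  -- finish, in the two symmetric cases
  rcases h2mem with rfl | rfl
  · -- `p₁ = 2`, `p₂` odd
    obtain ⟨ha5, hp3, hlaw₂, hval₂, hlaw₁, hsurj₁⟩ := propositionA_finish w cyc c hmul hone h2 hM hK hcyc hsup hc hN₁ hcop₁ hf₁
      hp₂ (Ne.symm hp₁₂) hb₂ hN₂ hcop₂ hf₂ hv0 rfl hc12 hsum
    refine ⟨dvd_trans (pow_dvd_pow 2 ha5) ⟨y₁, hN₁.symm⟩, p₂, b₁, b₂, y₁, y₂, f₁ c, f₁, f₂, hp₂, Ne.symm hp₁₂, hp3, ha5, hb₂, hN₁,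
      hcop₁, hN₂, hcop₂, hv0, hvmem, hf₁𝒱, hf₂𝒱, hf₁₂, rfl, hc12, hmem, hoddmem, hf₁, hf₂, hlaw₂, hval₂, hlaw₁, hsurj₁⟩
  · -- `p₂ = 2`, `p₁` odd
    have hsum' : ∀ γ : Gamma0 N, ∃ σ : G, w γ = f₂ σ + f₁ σ := fun γ ↦ by
      obtain ⟨σ, hσ⟩ := hsum γ; exact ⟨σ, by rw [hσ, add_comm]⟩
    obtain ⟨ha5, hp3, hlaw₂, hval₂, hlaw₁, hsurj₁⟩ := propositionA_finish w cyc c hmul hone h2 hM hK hcyc hsup hc hN₂ hcop₂ hf₂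
      hp₁ hp₁₂ hb₁ hN₁ hcop₁ hf₁ hv0 hc12 rfl hsum'
    refine ⟨dvd_trans (pow_dvd_pow 2 ha5) ⟨y₂, hN₂.symm⟩, p₁, b₂, b₁, y₂, y₁, f₁ c, f₂, f₁, hp₁, hp₁₂, hp3, ha5, hb₁, hN₂,
      hcop₂, hN₁, hcop₁, hv0, hvmem, hf₂𝒱, hf₁𝒱, Ne.symm hf₁₂, hc12, rfl, ?_, ?_, hf₂, hf₁, hlaw₂, hval₂, hlaw₁, hsurj₁⟩
    · intro f hf
      rcases hmem f hf with h | h | h | h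
      · exact Or.inl h
      · exact Or.inr (Or.inr (Or.inl h))
      · exact Or.inr (Or.inl h)
      · exact Or.inr (Or.inr (Or.inr (by rw [h, add_comm])))
    · intro f hf hfc
      rcases hoddmem f hf hfc with h | h
      · exact Or.inr h
      · exact Or.inl h

end Main

end Summit.BirchSwinnertonDyer.BirchSwinnertonDyer.Theorems.ManinLocalTwoThree.StepTwo
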